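import Literature.AlgebraicGeometry.Resolution.HasseSchmidtCoefficients
import Mathlib.RingTheory.MvPowerSeries.NoZeroDivisors
import Mathlib.RingTheory.MvPolynomial.Ideal
import Mathlib.Data.Nat.Factorial.Basic
import HarnessLib

/-!
# The order criterion for `J♯ = Σ_{j<b} (Diff^{≤ j} J)^{b!/(b−j)}` along a coordinate subspace of ANY
# codimension (Bravo–García-Escamilla–Villamayor 2012, Prop. 6.9; the formula of Hironaka 2017, Th. 3.10)

Topic: `Literature/AlgebraicGeometry/Resolution`. Companion of `HasseSchmidtDerivatives.lean`
(`diffIdeal_le_idealOfVars_iff`: the criterion at the origin itself, `W = {0}`) and of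
`HasseSchmidtTransverseOrder.lean` (`le_idealOfVars_pow_iff_forall_diffIdeal_le_sup`,
`Ideal.le_pow_iff_sharp_le_sup`: the criterion along a coordinate HYPERPLANE `W = {x_i = 0}`).
Here the subspace `W = {x_i = 0 : i ∈ S}` has arbitrary codimension `|S|` (any `S ⊆ σ`, `σ` any
index type), at the price of a domain of coefficients.

For an ideal `J` of `K[x_j : j ∈ σ]`, `b ∈ ℕ`, Grothendieck's `Diff^{≤ j}_{K[x]/K}(J) = diffIdeal K j J`
(`DifferentialOperators.lean`) and the origin `𝔪 = (x_j)_j = MvPolynomial.idealOfVars σ K`, write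
`J♯_b := Σ_{j=0}^{b−1} (Diff^{≤ j} J)^{b!/(b−j)}` — the expression of `Ideal.le_pow_iff_sharp_le_sup`
(Hironaka's `J♯` with `b♯ = b!`: *Resolution of singularities in positive characteristics*, ms. 2017,
Th. 3.10 p. 10, an UNREFEREED manuscript under adjudication; only its FORMULA is used here, nothing of
the manuscript is asserted). Then:

* `apply_mem_diffIdeal_add`, `diffIdeal_diffIdeal_le` — **orders add**: `D ∈ Diff^{≤ m}` maps
  `Diff^{≤ e}(J)` into `Diff^{≤ e+m}(J)` (EGA IV₄ 16.8.9; any commutative algebra over any base);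
* `sharp_le_pow_of_le_pow` — **`J ⊆ P^b ⇒ J♯_b ⊆ P^{b!}`** for ANY ideal `P` of any commutative
  algebra (`Diff^{≤ j}(J) ⊆ P^{b−j}` and `(b−j) · (b!/(b−j)) = b!`): "`Sing(J, b) ⊆ Sing(J♯_b, b!)`";
* **`le_idealOfVars_pow_iff_sharp_le_sup`** — THE CRITERION, for `K` a domain and every `S ⊆ σ`:
  **`J ⊆ 𝔪^b ⇔ J♯_b ⊆ 𝔪^{b!} + (x_i : i ∈ S)`**, i.e. "`ord_0 J ≥ b ⇔ ord_0 (J♯_b 𝒪_W) ≥ b!`" for the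
  coordinate subspace `W = V(x_i : i ∈ S) ≅ 𝔸^{σ∖S}` through the origin, of any codimension — the
  pointwise (closed point, no blow-up) content of the restriction property
  "`x ∈ Sing(𝒢) ∩ X ⇔ x ∈ Sing(Diff(𝒢)|_X)`" of [BGV12] Prop. 6.9 for `𝒢 = 𝒪_V[J W^b]`, `X = W`, at a
  `K`-point, in every characteristic; corollaries `le_idealOfVars_pow_iff_sharp_le` (`S = ∅`:
  `ord_0 J ≥ b ⇔ ord_0 J♯_b ≥ b!`), `…_sup_span_singleton` (`S = {i}`, the hypersurface form of
  `HasseSchmidtTransverseOrder.lean`, here without localising), `…_iff_sharp_le_idealOfVars`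
  (`S = σ`, `W` = the origin: `ord_0 J ≥ b ⇔ J♯_b ⊆ 𝔪`).

## Proof of `⇐` (the direction that needs smoothness of `W`, i.e. the transverse coordinates)

If `J ⊄ 𝔪^b`, some `f ∈ J` has a monomial `x^γ`, `|γ| < b`, with nonzero coefficient. Split
`γ = α + β` with `α` supported in `S` and `β` off `S`, and differentiate along `S` one variable at a
time with the Hasse–Schmidt derivatives `D^{(k e_i)}` (`hasseDeriv`, orders add:
`exists_mem_diffIdeal_coeff_ne_zero`): this produces `h ∈ Diff^{≤ |α|}(J)` with
`coeff_β h = coeff_γ f ≠ 0` (`coeff_hasseDeriv_single`: the binomials are `(k choose k) = 1`). Kill the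
variables of `S` by the `K`-algebra endomorphism `φ` (`x_i ↦ 0` for `i ∈ S`, `x_i ↦ x_i` otherwise):
`φ` maps `𝔪^c + (x_S)` into `𝔪^c` and does not change `β`-coefficients (`β` is `S`-free), so `φ h` has
order `≤ |β| < b − |α|` at the origin, hence (DOMAIN: orders of power series add, Mathlib's
`MvPowerSeries.order_prod`) `φ(h^N) = (φ h)^N`, `N = b!/(b−|α|)`, has order `< N (b − |α|) = b!`, while
`h^N ∈ (Diff^{≤|α|} J)^N ⊆ J♯_b ⊆ 𝔪^{b!} + (x_S)` forces `φ(h^N) ∈ 𝔪^{b!}` — contradiction.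

## What is NOT here
* Non-reduced coefficient rings: for `K = k[c]/(c²)`, `σ = {y}`, `S = {y}`, `J = (c y)`, `b = 2` one has
  `J ⊄ 𝔪²` but `J♯_2 = (cy) + (c)² = (cy) ⊆ 𝔪² + (y)` — the domain hypothesis in `⇐` is used.
* Other `K`-points (translate: `DerivativeIdealsOrder.exists_algEquiv_translate`; the transport of
  `diffIdeal` under `K`-algebra automorphisms is routine and not restated), non-coordinate smooth
  subvarieties (étale coordinates, EGA IV₄ 16.11.2), positive-dimensional centres, and anything after a
  blow-up (the persistence half of an "ambient reduction"; cf. `Hironaka2017/SharpSaturation.lean`).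

## References
* [BravoGarciaEscamillaVillamayor2012] A. Bravo, M. L. García-Escamilla, O. E. Villamayor U., *On Rees
  algebras and invariants for singularities over perfect fields*, Indiana Univ. Math. J. 61 (2012) =
  arXiv:1107.1797, Prop. 6.9 (restriction of `Diff(𝒢)` to a smooth closed subscheme `X ⊂ V` of any
  codimension: `𝓕_X((Diff 𝒢)|_X) = 𝓕_V(𝒢) ∩ 𝓕_V(𝒳)`; proof pp. 20–21, reduction to a hypersurface).
* [VillamayorU2008ReesDiff] O. Villamayor U., Rev. Mat. Iberoam. 24 (2008) = arXiv:math/0606795, §2.6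
  (Taylor operators `Δ^α`), §4.1 (order via `Diff^{b−1}(I)`).
* [EGAIV4] ÉGA IV₄, Prop. 16.8.9 (orders add under composition), Thm. 16.11.2.
* [Hironaka2017] H. Hironaka, manuscript (2017), Th. 3.10 p. 10 (the formula `J♯`, `b♯ = b!`;
  unrefereed, under adjudication — cited for the formula only).
-/

open MvPolynomial

namespace Literature.AlgebraicGeometry.Resolution

/-! ### Orders add on `Diff^{≤ e}(J)`; the easy inclusion `J ⊆ P^b ⇒ J♯_b ⊆ P^{b!}` -/

section General

variable (R : Type*) {A : Type*} [CommSemiring R] [CommRing A] [Algebra R A]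

/-- **Orders add** (EGA IV₄ 16.8.9) on the ideals `Diff^{≤ e}(J)`: a differential operator `D` of
order `≤ m` maps `Diff^{≤ e}(J)` into `Diff^{≤ e+m}(J)` — on a generator `Δ g` (`Δ ∈ Diff^{≤ e}`,
`g ∈ J`) because `D ∘ Δ ∈ Diff^{≤ m+e}`, on `a · x` because `D ∘ (a ·) ∈ Diff^{≤ m}`. (The special case
of the components of a Hasse–Schmidt derivation is `Hironaka2017/SharpSaturation.op_mem_diffIdeal_add`.)
[cite: EGAIV4, Prop. 16.8.9] -/
theorem apply_mem_diffIdeal_add {m e : ℕ} {D : A →ₗ[R] A} (hD : IsDiffOpLE R m D) {J : Ideal A}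
    {f : A} (hf : f ∈ diffIdeal R e J) : D f ∈ diffIdeal R (e + m) J := by
  suffices H : ∀ (m : ℕ) (D : A →ₗ[R] A), IsDiffOpLE R m D → D f ∈ diffIdeal R (e + m) J from
    H m D hD
  refine Submodule.span_induction
    (p := fun f _ => ∀ (m : ℕ) (D : A →ₗ[R] A), IsDiffOpLE R m D → D f ∈ diffIdeal R (e + m) J)
    ?_ ?_ ?_ ?_ hf
  · rintro _ ⟨Δ, hΔ, g, hg, rfl⟩ m D hD
    have h := apply_mem_diffIdeal R (hD.comp hΔ) hg
    rw [Nat.add_comm m e] at h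
    exact h
  · intro m D _
    rw [map_zero]
    exact zero_mem _
  · intro x z _ _ hx hz m D hD
    rw [map_add]
    exact add_mem (hx m D hD) (hz m D hD)
  · intro a x _ hx m D hD
    have h := hx m (D ∘ₗ LinearMap.mulLeft R a) (hD.comp (isDiffOpLE_mulLeft a))
    simpa only [LinearMap.comp_apply, LinearMap.mulLeft_apply, smul_eq_mul] using h

/-- `Diff^{≤ m}(Diff^{≤ e}(J)) ⊆ Diff^{≤ e+m}(J)`. [cite: EGAIV4, Prop. 16.8.9] -/
theorem diffIdeal_diffIdeal_le (m e : ℕ) (J : Ideal A) :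
    diffIdeal R m (diffIdeal R e J) ≤ diffIdeal R (e + m) J :=
  (diffIdeal_le_iff R).2 fun _ hD _ hf => apply_mem_diffIdeal_add R hD hf

/-- **`J ⊆ P^b ⇒ J♯_b ⊆ P^{b!}`** for ANY ideal `P` of any commutative algebra, where
`J♯_b = Σ_{j<b} (Diff^{≤ j}(J))^{b!/(b−j)}`: each summand lies in `(P^{b−j})^{b!/(b−j)} = P^{b!}`
(`diffIdeal_le_pow_sub`; `(b−j) ∣ b!` for `j < b`). At `P = 𝔪_ξ`: "`ord_ξ J ≥ b ⇒ ord_ξ J♯_b ≥ b!`",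
the easy half of the restriction property. [cite: BravoGarciaEscamillaVillamayor2012, Prop. 6.9 (proof: ν_x(h_i) ≥ b − i)] -/
theorem sharp_le_pow_of_le_pow {J P : Ideal A} {b : ℕ} (h : J ≤ P ^ b) :
    ∑ j ∈ Finset.range b, diffIdeal R j J ^ (b.factorial / (b - j)) ≤ P ^ b.factorial := by
  rw [Ideal.sum_eq_sup, Finset.sup_le_iff]
  intro j hj
  rw [Finset.mem_range] at hj
  have hmul : (b - j) * (b.factorial / (b - j)) = b.factorial :=
    Nat.mul_div_cancel' (Nat.dvd_factorial (by omega) (by omega))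
  calc diffIdeal R j J ^ (b.factorial / (b - j))
      ≤ (P ^ (b - j)) ^ (b.factorial / (b - j)) :=
        Ideal.pow_right_mono (diffIdeal_le_pow_sub R h j) _
    _ = P ^ b.factorial := by rw [← pow_mul, hmul]

end General

/-! ### The polynomial ring: killing the variables of `S`, differentiating along `S` -/

section Polynomial

variable {σ : Type*} {K : Type*} [CommRing K]

/-- A `K`-algebra endomorphism of `K[x]` killing the variables of `S` and fixing the others exists
(`x_i ↦ 0` for `i ∈ S`, `x_i ↦ x_i` otherwise: the retraction onto `K[x_j : j ∉ S]`, i.e. restriction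
to the coordinate subspace `W = V(x_i : i ∈ S)` followed by the inclusion). [folklore] -/
private theorem exists_killVars (S : Set σ) :
    ∃ φ : MvPolynomial σ K →ₐ[K] MvPolynomial σ K,
      (∀ i ∈ S, φ (X i) = 0) ∧ ∀ i ∉ S, φ (X i) = X i := by
  classical
  exact ⟨aeval fun i => if i ∈ S then (0 : MvPolynomial σ K) else X i,
    fun i hi => by simp [hi], fun i hi => by simp [hi]⟩

/-- Such an endomorphism fixes the monomials not involving `S`. [folklore] -/
private theorem killVars_monomial_of_forall {S : Set σ}
    (φ : MvPolynomial σ K →ₐ[K] MvPolynomial σ K) (hT : ∀ i ∉ S, φ (X i) = X i) {δ : σ →₀ ℕ} (hδ : ∀ i ∈ S, δ i = 0) (c : K) :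
    φ (monomial δ c) = monomial δ c := by
  rw [monomial_eq, map_mul, ← MvPolynomial.algebraMap_eq, AlgHom.commutes, map_finsuppProd]
  congr 1
  refine Finsupp.prod_congr fun i hi => ?_
  have hiS : i ∉ S := fun h => (Finsupp.mem_support_iff.1 hi) (hδ i h)
  rw [map_pow, hT i hiS]

/-- … and kills the monomials involving some variable of `S`. [folklore] -/
private theorem killVars_monomial_of_mem {S : Set σ}
    (φ : MvPolynomial σ K →ₐ[K] MvPolynomial σ K) (hS : ∀ i ∈ S, φ (X i) = 0) {δ : σ →₀ ℕ} {i : σ} (hi : i ∈ S) (hδ : δ i ≠ 0) (c : K) :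
    φ (monomial δ c) = 0 := by
  classical
  have h : (monomial δ c : MvPolynomial σ K) = monomial (δ.erase i) c * X i ^ (δ i) := by
    rw [X_pow_eq_monomial, monomial_mul, mul_one, Finsupp.erase_add_single]
  rw [h, map_mul, map_pow, hS i hi, zero_pow hδ, mul_zero]

/-- Hence it does not change the coefficients of `S`-free exponents: `coeff_β (φ q) = coeff_β q` when
`β_i = 0` for all `i ∈ S`. [folklore] -/
private theorem coeff_killVars_of_forall {S : Set σ}
    (φ : MvPolynomial σ K →ₐ[K] MvPolynomial σ K) (hS : ∀ i ∈ S, φ (X i) = 0) (hT : ∀ i ∉ S, φ (X i) = X i) {β : σ →₀ ℕ}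
    (hβ : ∀ i ∈ S, β i = 0) (q : MvPolynomial σ K) : coeff β (φ q) = coeff β q := by
  classical
  induction q using MvPolynomial.induction_on' with
  | add p q hp hq => rw [map_add, coeff_add, coeff_add, hp, hq]
  | monomial δ c =>
    by_cases hδ : ∀ i ∈ S, δ i = 0
    · rw [killVars_monomial_of_forall φ hT hδ]
    · push Not at hδ
      obtain ⟨i, hiS, hi⟩ := hδ
      rw [killVars_monomial_of_mem φ hS hiS hi, coeff_zero, coeff_monomial, if_neg]
      rintro rfl
      exact hi (hβ i hiS)

/-- … and maps `𝔪^c + (x_i : i ∈ S)` into `𝔪^c` (`φ(𝔪) ⊆ 𝔪`, `φ(x_S) = 0`): "restriction to `W`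
does not lower the order at the origin". [folklore] -/
private theorem killVars_mem_pow_of_mem_sup {S : Set σ}
    (φ : MvPolynomial σ K →ₐ[K] MvPolynomial σ K) (hS : ∀ i ∈ S, φ (X i) = 0) (hT : ∀ i ∉ S, φ (X i) = X i) {c : ℕ} {q : MvPolynomial σ K}
    (hq : q ∈ idealOfVars σ K ^ c ⊔ Ideal.span (X '' S)) : φ q ∈ idealOfVars σ K ^ c := by
  classical
  have h1 : Ideal.map φ (idealOfVars σ K) ≤ idealOfVars σ K := by
    change Ideal.map φ (Ideal.span _) ≤ _
    rw [Ideal.map_span, Ideal.span_le]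
    rintro _ ⟨_, ⟨i, rfl⟩, rfl⟩
    by_cases hi : i ∈ S
    · rw [hS i hi]; exact zero_mem _
    · rw [hT i hi]; exact Ideal.subset_span ⟨i, rfl⟩
  have h2 : Ideal.map φ (Ideal.span (X '' S)) = ⊥ := by
    rw [Ideal.map_span, Ideal.span_eq_bot]
    rintro _ ⟨_, ⟨i, hi, rfl⟩, rfl⟩
    exact hS i hi
  have h3 : Ideal.map φ (idealOfVars σ K ^ c ⊔ Ideal.span (X '' S)) ≤ idealOfVars σ K ^ c := by
    rw [Ideal.map_sup, h2, sup_bot_eq, Ideal.map_pow]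
    exact Ideal.pow_right_mono h1 c
  exact h3 (Ideal.mem_map_of_mem φ hq)

/-- **Differentiating along `S`, one variable at a time.** If `f ∈ Diff^{≤ e}(J)` has `coeff_γ f ≠ 0`
and the `S`-part of `γ` is supported in the finite set `s`, then there is `h ∈ Diff^{≤ j}(J)` with a
nonzero coefficient at an `S`-FREE exponent `β` and `j + |β| ≤ e + |γ|` (apply `D^{(γ_i e_i)}` for
`i ∈ s`: `coeff_{γ − γ_i e_i}(D^{(γ_i e_i)} f) = (γ_i choose γ_i) coeff_γ f`, orders add).
[cite: VillamayorU2008ReesDiff, §4.1 (Δ^α(f) has constant term coeff_α f)] -/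
theorem exists_mem_diffIdeal_coeff_ne_zero [DecidableEq σ] (S : Set σ)
    (J : Ideal (MvPolynomial σ K)) :
    ∀ (s : Finset σ) {e : ℕ} {f : MvPolynomial σ K} {γ : σ →₀ ℕ},
      f ∈ diffIdeal K e J → coeff γ f ≠ 0 → (∀ i ∈ S, γ i ≠ 0 → i ∈ s) →
      ∃ (j : ℕ) (β : σ →₀ ℕ) (h : MvPolynomial σ K), h ∈ diffIdeal K j J ∧ coeff β h ≠ 0 ∧
        (∀ i ∈ S, β i = 0) ∧ j + β.degree ≤ e + γ.degree := by
  intro s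
  induction s using Finset.induction_on with
  | empty =>
    intro e f γ hf hγ hs
    exact ⟨e, γ, f, hf, hγ, fun i hi => by_contra fun h => Finset.notMem_empty i (hs i hi h),
      le_rfl⟩
  | insert i s _ ih =>
    intro e f γ hf hγ hs
    -- differentiate `γ i` times along `x_i`
    have hf₁ : hasseDeriv K (Finsupp.single i (γ i)) f ∈ diffIdeal K (e + γ i) J :=
      apply_mem_diffIdeal_add K
        (isDiffOpLE_hasseDeriv K (γ i) _ (by rw [Finsupp.degree_single])) hf
    have hγ₁ : coeff (γ.erase i) (hasseDeriv K (Finsupp.single i (γ i)) f) ≠ 0 := by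
      rw [coeff_hasseDeriv_single, Finsupp.erase_same, zero_add, Nat.choose_self, Nat.cast_one,
        one_mul, Finsupp.erase_add_single]
      exact hγ
    have hs₁ : ∀ i' ∈ S, (γ.erase i) i' ≠ 0 → i' ∈ s := by
      intro i' hi'S hi'
      have hne : i' ≠ i := by
        rintro rfl
        exact hi' (Finsupp.erase_same)
      rw [Finsupp.erase_ne hne] at hi'
      exact (Finset.mem_insert.1 (hs i' hi'S hi')).resolve_left hne
    obtain ⟨j, β, h, hh, hβh, hβS, hle⟩ := ih hf₁ hγ₁ hs₁
    refine ⟨j, β, h, hh, hβh, hβS, ?_⟩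
    have hdeg : (γ.erase i).degree + γ i = γ.degree := by
      conv_rhs => rw [← Finsupp.erase_add_single i γ]
      rw [map_add, Finsupp.degree_single]
    omega

/-- **Powers do not gain order over a domain**: if `coeff_β g ≠ 0` and `N · |β| < c` then
`g^N ∉ 𝔪^c` (`ord_0 (g^N) = N · ord_0 g ≤ N |β|`; orders of power series over a domain add,
`MvPowerSeries.order_prod`). [folklore] -/
private theorem pow_not_mem_pow_idealOfVars [NoZeroDivisors K] {g : MvPolynomial σ K}
    {β : σ →₀ ℕ} (hβ : coeff β g ≠ 0) {N c : ℕ} (hlt : N * β.degree < c) :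
    g ^ N ∉ idealOfVars σ K ^ c := by
  haveI : Nontrivial K := nontrivial_of_ne _ _ hβ
  intro hmem
  rw [mem_pow_idealOfVars_iff'] at hmem
  have hg : (g : MvPowerSeries σ K).order ≤ (β.degree : ℕ∞) :=
    MvPowerSeries.order_le (by rwa [MvPolynomial.coeff_coe])
  have hpow : ((g ^ N : MvPolynomial σ K) : MvPowerSeries σ K).order =
      N • (g : MvPowerSeries σ K).order := by
    rw [MvPolynomial.coe_pow, Finset.pow_eq_prod_const, MvPowerSeries.order_prod, Finset.sum_const,
      Finset.card_range]
  have hle : ((g ^ N : MvPolynomial σ K) : MvPowerSeries σ K).order ≤ ((N * β.degree : ℕ) : ℕ∞) := by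
    rw [hpow, Nat.cast_mul, ← nsmul_eq_mul]
    exact nsmul_le_nsmul_right hg N
  have hfin : ((g ^ N : MvPolynomial σ K) : MvPowerSeries σ K).order.toNat =
      ((g ^ N : MvPolynomial σ K) : MvPowerSeries σ K).order :=
    ENat.coe_toNat (ne_top_of_le_ne_top (ENat.coe_ne_top _) hle)
  obtain ⟨d, hd, hdeg⟩ := MvPowerSeries.exists_coeff_ne_zero_and_order hfin
  have hdc : d.degree < c := by
    have h1 : (d.degree : ℕ∞) ≤ ((N * β.degree : ℕ) : ℕ∞) := hdeg ▸ hle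
    exact lt_of_le_of_lt (by exact_mod_cast h1) hlt
  rw [MvPolynomial.coeff_coe] at hd
  exact hd (hmem d hdc)

/-- **The order criterion for `J♯_b` along a coordinate subspace of any codimension, every
characteristic.** For a domain `K`, any index type `σ`, any `S ⊆ σ` (the subspace
`W = V(x_i : i ∈ S) ≅ 𝔸^{σ∖S}` through the origin, of codimension `|S|`), any ideal `J ⊆ K[x_σ]` and
any `b ∈ ℕ` (both sides are trivially true for `b = 0`), with `𝔪 = (x_j)_{j ∈ σ}` and
`J♯_b = Σ_{j<b} (Diff^{≤ j}_{K[x]/K} J)^{b!/(b−j)}`: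
**`J ⊆ 𝔪^b ⇔ J♯_b ⊆ 𝔪^{b!} + (x_i : i ∈ S)`** — "`ord_0 J ≥ b ⇔ ord_0 (J♯_b 𝒪_W) ≥ b!`",
"`0 ∈ Sing(J, b) ⇔ 0 ∈ Sing(J♯_b 𝒪_W, b!)`", the pointwise restriction property for the marked ideal
`(J, b)` and the smooth subvariety `W`, at a rational point, in every codimension (the hypersurface
case `S = {i}` over any base ring, localised, is `Ideal.le_pow_iff_sharp_le_sup`).
[cite: BravoGarciaEscamillaVillamayor2012, Prop. 6.9 (x ∈ Sing(𝒢) ∩ X ⇔ x ∈ Sing(Diff(𝒢)|_X), X ⊂ V smooth closed of any codimension; pointwise form at a rational point of affine space)] -/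
theorem le_idealOfVars_pow_iff_sharp_le_sup [IsDomain K] (S : Set σ)
    (J : Ideal (MvPolynomial σ K)) (b : ℕ) :
    J ≤ idealOfVars σ K ^ b ↔
      ∑ j ∈ Finset.range b, diffIdeal K j J ^ (b.factorial / (b - j)) ≤
        idealOfVars σ K ^ b.factorial ⊔ Ideal.span (X '' S) := by
  classical
  refine ⟨fun h => (sharp_le_pow_of_le_pow K h).trans le_sup_left, fun h => ?_⟩
  by_contra hJ
  obtain ⟨f, hfJ, hf⟩ := (SetLike.not_le_iff_exists.1 hJ)
  rw [mem_pow_idealOfVars_iff'] at hf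
  push Not at hf
  obtain ⟨γ, hγb, hγ⟩ := hf
  -- differentiate away the `S`-part of `γ`
  obtain ⟨j, β, g, hg, hβg, hβS, hle⟩ :=
    exists_mem_diffIdeal_coeff_ne_zero S J (γ.support.filter (· ∈ S)) (le_diffIdeal K 0 J hfJ) hγ
      (fun i hi hγi => Finset.mem_filter.2 ⟨Finsupp.mem_support_iff.2 hγi, hi⟩)
  have hjb : j < b := by omega
  have hdvd : (b - j) ∣ b.factorial := Nat.dvd_factorial (by omega) (by omega)
  have hNmul : b.factorial / (b - j) * (b - j) = b.factorial := Nat.div_mul_cancel hdvd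
  have hNpos : 0 < b.factorial / (b - j) :=
    Nat.div_pos (Nat.le_of_dvd (Nat.factorial_pos b) hdvd) (by omega)
  -- `g^N ∈ (Diff^{≤ j} J)^N ⊆ J♯_b ⊆ 𝔪^{b!} + (x_S)`
  have hgN : g ^ (b.factorial / (b - j)) ∈ idealOfVars σ K ^ b.factorial ⊔ Ideal.span (X '' S) := by
    refine h ?_
    have hle' : diffIdeal K j J ^ (b.factorial / (b - j)) ≤
        ∑ j ∈ Finset.range b, diffIdeal K j J ^ (b.factorial / (b - j)) := by
      rw [Ideal.sum_eq_sup]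
      exact Finset.le_sup (f := fun j => diffIdeal K j J ^ (b.factorial / (b - j)))
        (Finset.mem_range.2 hjb)
    exact hle' (Ideal.pow_mem_pow hg _)
  -- kill the variables of `S`
  obtain ⟨φ, hφS, hφT⟩ := exists_killVars (K := K) S
  have hφgN : φ g ^ (b.factorial / (b - j)) ∈ idealOfVars σ K ^ b.factorial := by
    rw [← map_pow]
    exact killVars_mem_pow_of_mem_sup φ hφS hφT hgN
  have hβφ : coeff β (φ g) ≠ 0 := by
    rwa [coeff_killVars_of_forall φ hφS hφT hβS]
  refine pow_not_mem_pow_idealOfVars hβφ ?_ hφgN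
  have hβlt : β.degree < b - j := by omega
  calc b.factorial / (b - j) * β.degree
      < b.factorial / (b - j) * (b - j) := (Nat.mul_lt_mul_left hNpos).2 hβlt
    _ = b.factorial := hNmul

/-- **`S = ∅`, the ambient space itself**: `J ⊆ 𝔪^b ⇔ J♯_b ⊆ 𝔪^{b!}` — "`ord_0 J ≥ b ⇔ ord_0 J♯_b ≥ b!`",
"`Sing(J, b) = Sing(J♯_b, b!)` at the origin" (domain `K`, every characteristic).
[cite: BravoGarciaEscamillaVillamayor2012, Prop. 6.9 (with X = V)] -/
theorem le_idealOfVars_pow_iff_sharp_le [IsDomain K] (J : Ideal (MvPolynomial σ K)) (b : ℕ) :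
    J ≤ idealOfVars σ K ^ b ↔
      ∑ j ∈ Finset.range b, diffIdeal K j J ^ (b.factorial / (b - j)) ≤
        idealOfVars σ K ^ b.factorial := by
  have h := le_idealOfVars_pow_iff_sharp_le_sup (∅ : Set σ) J b
  rwa [Set.image_empty, Ideal.span_empty, sup_bot_eq] at h

/-- **`S = {i}`, a coordinate hyperplane** (the shape of `Ideal.le_pow_iff_sharp_le_sup`, here in the
polynomial ring itself, domain `K`): `J ⊆ 𝔪^b ⇔ J♯_b ⊆ 𝔪^{b!} + (x_i)`.
[cite: BravoGarciaEscamillaVillamayor2012, Prop. 6.9 (hypersurface case)] -/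
theorem le_idealOfVars_pow_iff_sharp_le_sup_span_singleton [IsDomain K] (i : σ)
    (J : Ideal (MvPolynomial σ K)) (b : ℕ) :
    J ≤ idealOfVars σ K ^ b ↔
      ∑ j ∈ Finset.range b, diffIdeal K j J ^ (b.factorial / (b - j)) ≤
        idealOfVars σ K ^ b.factorial ⊔ Ideal.span {X i} := by
  have h := le_idealOfVars_pow_iff_sharp_le_sup ({i} : Set σ) J b
  rwa [Set.image_singleton] at h

/-- **`S = σ`, the origin as the subspace** (`W = {0}`, all variables killed):
`J ⊆ 𝔪^b ⇔ J♯_b ⊆ 𝔪` — every generator `∏ Δ_k(f_k)` of `J♯_b` vanishes at `0` (both sides trivial for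
`b = 0`); compare `diffIdeal_le_idealOfVars_iff` (`Diff^{≤ b−1}(J) ⊆ 𝔪 ⇔ J ⊆ 𝔪^b`, any base ring).
[cite: VillamayorU2008ReesDiff, §4.1 (Diff^{b−1}(I) proper iff order ≥ b)] -/
theorem le_idealOfVars_pow_iff_sharp_le_idealOfVars [IsDomain K] (J : Ideal (MvPolynomial σ K))
    (b : ℕ) :
    J ≤ idealOfVars σ K ^ b ↔
      ∑ j ∈ Finset.range b, diffIdeal K j J ^ (b.factorial / (b - j)) ≤ idealOfVars σ K := by
  have h := le_idealOfVars_pow_iff_sharp_le_sup (Set.univ : Set σ) J b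
  have huniv : Ideal.span (X '' (Set.univ : Set σ)) = idealOfVars σ K := by
    rw [Set.image_univ]
  rwa [huniv, sup_eq_right.2 (Ideal.pow_le_self (Nat.factorial_ne_zero b))] at h

end Polynomial

end Literature.AlgebraicGeometry.Resolution
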